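import Mathlib
import HarnessLib
import HarnessLib.Audit
import Summits.KontsevichZagierPeriods.Statement
import HarnessLib.Audit.Status.Attr

/-!
Route: K2SymbolChains

DORMANT since 2026-08-25T03:54:16Z (reconciler: no traction for 7.3 d (last activity item-evidence-added at 2026-08-17T19:00:36Z); parked, not closed — `ledger route dormant route-KontsevichZagierPeriods-K2SymbolChains --off` to reactiv) — unstaffed, not closed; items shared with open routes are served there. `ledger route dormant <id> --off` reactivates.

# Route K2SymbolChains — the K2 symbol calculus compiles — Jensen is a move, Steinberg is a chain,
so Mahler identities with a witness are KZ-accessible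

It suffices to show X = (E) ∧ (K) (card k2-steinberg-calculus-mahler-boyd, salvaging the Smyth
calibration of the retired twin
k-theory-steinberg-certificates-mahler). (E) THE SYMBOL ENGINE — the K₂(curve) symbol calculus is
DERIVABLE in the fixed H21 calculus once
logarithms are unfolded into a fibre variable (log v = ∫₁^v du/u): (E1) JensenMove — the torus
average of the unfolded log|e^{iφ} − α(x)|,
fibrewise over any ℚ-semialgebraic base, may be replaced by 2π·log⁺|α(x)| ("Jensen = a move"; it
turns every Mahler torus representation into
a regulator representation ∫ η(x,y) over the Deninger cycle); (E2) SteinbergChain — for a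
semialgebraic arc γ in ℂ∖{0,1} the unfolded
representations of ∫_γ η(w,1−w), η(f,g) = log|f| d arg g − log|g| d arg f, differ from the ray
(Bloch–Wigner) representations ρ(γ(b)) − ρ(γ(a))
by moves ("Steinberg is a chain"; with rule 2 along cycles and MultivaluedCoV.SheetTransfer for
isogenies this is the whole symbol calculus
S1–S5 of the card). (K) SymbolKernel — the kernel conjecture for the calculus ENLARGED by the two
symbol rules (summit-strength, stated openly;
on the regulator sector it is Beilinson-regulator injectivity modulo S1–S5). Typed first fruits:
SmythCalibration (M(1+x+y) ~ 4π·D(ζ₆)),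
BoydLalinExercise (KZ's own p. 9 exercise 6·M(P₁₆) ~ 11·M(P₅), a LITERAL IsRational instance of the
summit), FigureEightIsTwoSmyth, ClausenPiVanishes.
Lean: `JensenMove ∧ SteinbergChain ∧ SymbolKernel`

## Assembly
Pure logic plus the tree's kernel-form theorem (PROVED as an `example` in the planner's Sketch.lean,
rc 0): given JensenMove and
SteinbergChain, specialise SymbolKernel at R := KZ.relations (le_rfl; the two closure hypotheses are
literally the two cruxes) to get
∀ c, KZ.eval c = 0 → c ∈ KZ.relations = Literature.NumberTheory.Transcendental.KZKernelConjecture,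
then
Summit.KontsevichZagierPeriods.KernelForm.kontsevichZagierPeriods_of_kzKernelConjecture
(Theorems/KernelFormKernelImpliesStatement.lean).

Rationale: WHY THIS LINE. Every proof of a relation between two Mahler measures or regulator periods that does
not pass through an L-value has the shape (symbol
manipulation in K₂ of the function field) + (Jensen) + (Stokes for the closed form η) + (dilogarithm
evaluations): Deninger1997 and
RodriguezVillegas1999 (m(P) − m(P*) = −(1/2π)∫_{γ_P} η(x,y) by Jensen), BoydRodriguezVillegas2002 /
BoydRodriguezVillegas2005 (η(f,1−f) = dD, gluing
equations as K₂ witnesses, π·m(A_{4₁}) = vol(4₁)), LalinRogers2007 / Lalin2010 (KZ's 16-vs-5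
exercise, KontsevichZagier2001 p. 9, proved via
regulators and diamond operations); the route reads these ingredients as DERIVED RULES of the fixed
calculus and files the two that are not
already routes (Jensen; Steinberg/η-Stokes) plus typed Mahler targets. Imported area: algebraic
K-theory of curves and the Beilinson/Bloch
regulator (Bloch2011, BrunaultZudilin2020) with the explicit dictionary symbol {f,g} ↦ pair of
unfolded reps of ∫_γ η(f,g), Steinberg relator
↦ SteinbergChain instance, tame symbol/constants ↦ Baker-sector reps (route LowDimension), isogeny ↦
sheet transfer (route MultivaluedCoV),
K₂-witness ↦ move chain. New versus every open route: LowDimension stops at dimension 1 (Baker),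
LiouvilleUnfolding derives logarithmic
PRIMITIVES, MultivaluedCoV derives correspondences — none types a weight-2 mixed (non-Tate,
regulator) identity; this line does, and it finds
that Jensen's formula is derivable WITHOUT rule 3 (doubling + radial dilation: support
JensenIsScissors) while the classical proofs
(ρ^{2^n} → 0 limit, mean value via the Green function log, residue at the centre) are not finite
chains, and that KZ's 'accessible' exercise
hides a genuinely open step (a finite lift of Lalín's torsion-supported diamond relation). Negatives
index: empty at filing.

RANKED CRUXES. #0 SymbolKernel (target) — kernel conjecture of the SIX-rule calculus KZ ∪ {Jensen
rule, Steinberg-chain rule}: every subgroup R ≥ KZ.relations closed under all JensenMove instances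
and all SteinbergChain instances contains ker KZ.eval (X's open core (K); KZKernelConjecture ⇒ it
trivially, proved in Sketch.lean; with cruxes 2–3 it ⇒ KZKernelConjecture = the Assembly). (why it
might fail: Summit-strength: KZKernelConjecture ⇒ it, and with cruxes 2–3 it ⇒ KZKernelConjecture;
the three strength barriers apply verbatim; on the K₂ sector it contains Beilinson-regulator
injectivity (Goncharov1999 Conj. 2.8 analogue), wide open.) [KontsevichZagier2001,
HuberMullerStach2017, Goncharov1999, Bloch2011]
#2 SteinbergChain (crux) — STEINBERG IS A CHAIN (card S3). For a < b and a ℚ-semialgebraic arc γ =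
(γ₁,γ₂) on [a,b], continuous, differentiable inside, with γ(t) ≠ 0 and the segment [0,γ(t)] avoiding
w = 1 for all t ∈ [a,b]: the two unfolded 2-dim representations r₁ = [{a<t<b, u between 1 and |γ|²},
±(d/dt arg(1−γ))/(2u)] (= ∫ log|w| d arg(1−w)) and r₂ = [{a<t<b, u between 1 and |1−γ|²}, ±(d/dt arg
γ)/(2u)] (= ∫ log|1−w| d arg w), and the ray representations ρ(z) = [{0<s<1, u between 1 and
s²|z|²}, ∓q/(2u|1−sz|²)] of the Bloch–Wigner dilogarithm D(z) (z = p+iq; value D(z), ray formula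
certified numerically) at z = γ(a), γ(b), satisfy of r₁ − of r₂ − of ρ(γ(b)) + of ρ(γ(a)) ∈
KZ.relations. Value identity: ∫_γ η(w,1−w) = D(γ(b)) − D(γ(a)) (η(w,1−w) = dD exact on ℂ∖{0,1}).
Intended chain: zero-bulk Stokes for the pull-back of the unfolded η under (s,t) ↦ s·γ(t) on the
rectangle (0,1)×(a,b) (the cone), by cylindrical decomposition with Newton–Leibniz along t/u and
change of variables u = |sγ|², |1−sγ|² on monotonicity cells; edges s = 1 (the arc), t = a, b (the
rays), s → 0 (degenerate, integrable apex). [difficulty: L] (why it might fail: Apex w=0 is a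
puncture of η(w,1−w) and Newton–Leibniz along the ray parameter has arctan primitives, so the
zero-bulk Stokes must run along u or t on CAD cells of the unfolded cone; a cell reaching u→0 can
break rule 3's closed-fibre continuity or absolute integrability.) [Bloch2011,
Zagier2007Dilogarithm, BoydRodriguezVillegas2002, KontsevichZagier2001, BochnakCosteRoy1998]
#3 JensenMove (crux) — JENSEN IS A MOVE (card: 'Jensen = Stokes', fibrewise). Over any
ℚ-semialgebraic base τ ⊆ ℝⁿ with semialgebraic weight h and centre α = α₁ + iα₂ on τ (weight
integrable against 1 + |log|α|²|): the (n+2)-dim representation r = [{x ∈ τ, s ∈ ℝ, u between 1 and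
W}, ±h(x)/((1+s²)u)], W = |e(s) − α(x)|², e(s) = ((1−s²)+2is)/(1+s²) (value ∫_τ h·J(α), J(α) =
∫₀^{2π} log|e^{iφ}−α|dφ) and r′ = [{x ∈ τ, |α(x)| > 1, s ∈ ℝ, 1 < u < |α(x)|²}, h(x)/((1+s²)u)]
(value ∫_τ h·2π log⁺|α|) satisfy of r − of r′ ∈ KZ.relations. Paper chain found by the planner
(fibrewise, uniform in x): |α|<1: rotation (rule 2, Möbius in s), DOUBLING 2[J(α)] ~ [J(α²)]
(log|e−α|+log|e+α| = log|e²−α²|: unfolded S1 = 1a + dilation, two-sheeted ψ = 2φ = rule 2 twice,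
shift by π), RADIAL CONSTANCY [J(ρ)] ~ [J(ρ²)] (refold to the (r,t)-plane rep of ∂_r log W on
(ρ²,ρ)×ℝ by u = W(r,t) on the cells r ≷ cos φ; its integrand is (1/r)[1/(1+t²) − c/(1+c²t²)], c =
(1+r)/(1−r), and ONE fibrewise dilation (r,t) ↦ (r,ct) identifies the two summands), hence [J] =
2[J] − [J] ~ [J(ρ²)] − [J(ρ²)]·… ∈ relations with NO division by 2; |α| = 1: doubling alone; |α| >
1: unfolded S1 splits off log|α|² → r′ and inversion φ ↦ −φ. [difficulty: L] (why it might fail: No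
division, no limits: the ρ^{2^n}→0, mean-value (log = Green primitive) and residue proofs are NOT
chains; the finite chain (doubling 2J(α)~J(α²) + radial constancy by the fibrewise dilation
t↦(1+r)t/(1−r)) needs C¹ cells for discontinuous semialgebraic α,h (BCR CAD, not in tree).)
[Jensen1899, MckeeSmyth2021, Deninger1997, KontsevichZagier2001, BochnakCosteRoy1998]
#4 SmythCalibration (crux) — SMYTH'S FORMULA AS A CHAIN (first Lean calibration of the sector,
salvaged from the retired twin card): the unfolded torus representation of M(1+x+y) := ∫∫ log|1 +
e^{iθ} + e^{iφ}| dθdφ = 4π²·m(1+x+y) (3-dim: t,s rational circle parameters, u the unfolded log,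
integrand ±2/((1+t²)(1+s²)u)) is KZ-equivalent to the 3-dim representation [ℝ_t × {0<s<1, s²<u<1},
√3/((1+t²)·u·(1−s+s²))] = (∫dt/(1+t²)) ⊗ 2·2ρ(ζ₆) of 4π·D(e^{iπ/3}); values 12.754… agree
(Smyth1981: m(1+x+y) = L′(χ₋₃,−1) = D(e^{iπ/3})/π; MckeeSmyth2021 Prop. 2.42, Ex. 2.43). Predicted
chain: JensenMove in φ with α(t) = −(1+x(t)) (Deninger cycle = arc |θ| < 2π/3), then {x,−1−x}: w =
−x turns η(x,1+x) into η(w,1−w) = dD along the unit-circle arc from ζ₆⁻¹ to ζ₆ through −1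
(SteinbergChain on two sub-arcs, cone = unit sector avoiding 1), and ρ(z̄) = −ρ(z) (rule 1b). [deps:
JensenMove, SteinbergChain] [difficulty: M] (why it might fail: Values: Smyth 1981 (re-certified
here to 1e−6), so a failure is the SUMMIT failing on a 3-dim pair; as typed the risk is the
unit-circle arc through w=−1 (vertical tangent) and the endpoint rays at ζ₆^{±1}: every intermediate
rep must stay absolutely integrable.) [Smyth1981, MckeeSmyth2021, BoydRodriguezVillegas2002,
RodriguezVillegas1999]
#5 BoydLalinExercise (crux) — KZ'S OWN EXERCISE (KontsevichZagier2001 §1.2 p. 9: 'the reader may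
like to try proving the accessible identity μ(x+y+16+1/x+1/y) = (11/6)·μ(x+y+5+1/x+1/y) using only
the rules 1)–3)'). On the torus P_k = x+1/x+y+1/y+k = 2cos θ + 2cos φ + k is REAL and ≥ 1 for k = 5,
16, so the unfolded torus representations are literally of KZ's rational shape: r = [{1 < u <
(2c(t)+2c(s)+16)²}, 12/((1+t²)(1+s²)u)], r′ = [{1 < u < (2c(t)+2c(s)+5)²}, 22/((1+t²)(1+s²)u)], c(t)
= (1−t²)/(1+t²), with values 6·4π²m(16) = 11·4π²m(5) (Lalin2010: m(16) = (11/6)m(5) = 11m(1); ratio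
re-certified here to 1e−13). Claim: KZ.Equivalent r r′ — an instance of the summit's hypothesis
(both IsRational; summit ⇒ item checked in Sketch.lean). Predicted chain: JensenMove twice per side
(roots y_±(θ) real algebraic), functional equations m(1)+m(16) = 2m(5), m(5)+m(−3i) = m(16)
(Kurokawa–Ochiai / LalinRogers2007: products + 2-sheeted torus maps = sheet transfer), the twist
isomorphism (X,Y) ↦ (−X,iY) as rule 2 on E(ℂ) ⊂ ℝ⁴ read through the cycle, and a FINITE Steinberg
witness lifting Lalín's diamond relation 10(P) ~ 12(P+Q) (torsion points P, Q, A, B; functions f, g,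
g^σ) — the open step. [deps: JensenMove, SteinbergChain] [difficulty: XL] (why it might fail:
Lalín's proof runs through Bloch's elliptic dilogarithm (r = D_E∘◇, a Kronecker–Eisenstein series),
not a finite symbol identity; a chain needs an unpublished lift of the torsion-supported diamond
relation 10(P)~12(P+Q) to Λ²ℚ̄(E)^×⊗ℚ mod Steinberg+constants, else KZ's 'accessible identity' is
open.) [KontsevichZagier2001, Lalin2010, LalinRogers2007, Boyd1998, RodriguezVillegas1999,
Brunault2008, Bloch2011]
#9 ClausenPiVanishes (support) — Cl₂(π) = ∫₀^π log(2 sin(φ/2)) dφ = 0, i.e. Jensen at |α| = 1, as a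
GENUINE summit instance in dimension 2: the rational representations [{1 < u < 4t²/(1+t²)},
1/((1+t²)u)] and [{4t²/(1+t²) < u < 1}, 1/((1+t²)u)] (the positive and negative parts of the
unfolded ∫ log|1−e^{iφ}| dφ) have equal values and are KZ-equivalent. Paper chain (planner, 5 moves,
NO Newton–Leibniz): doubling — log|1−e^{iφ}| + log|1+e^{iφ}| = log|1−e^{2iφ}| (unfolded: 1a +
dilation u ↦ u/V), shift φ ↦ φ+π (Möbius t ↦ −1/t, rule 2), two-sheeted ψ = 2φ (rule 2 on two
half-circles + 1b) give 2[J(1)] ~ [J(1)], hence [J(1)] ∈ relations. Cheapest prover warm-up with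
exactly the cells of JensenMove. [difficulty: provable-now] [MckeeSmyth2021, Zagier2007Dilogarithm,
KontsevichZagier2001]
#9 FigureEightIsTwoSmyth (support) — MAHLER = VOLUME, first instance (card corpus II): for the
A-polynomial of the figure-eight knot A(L,M) = M⁴+M⁻⁴−M²−M⁻²−2−L−L⁻¹ one has |A| = |16c⁴−20c²+2−2cos
φ| on the torus (c = cos θ) and π·m(A) = vol(4₁) = 2D(e^{iπ/3}) = 2π·m(1+x+y) (Boyd2002Hyperbolic;
BoydRodriguezVillegas2005; ratio re-certified here to 4e−7): the unfolded torus representation of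
M(A) (integrand ±2/((1+t²)(1+s²)u)) is KZ-equivalent to that of 2·M(1+x+y) (integrand ±4/(…)).
Predicted chain: JensenMove (roots L_±(θ) real algebraic, |L₋| ≥ 1 iff |c(θ)| ≥ 2), then the
gluing-equation witness z∧(1−z) of the two regular ideal tetrahedra (shape field ℚ(ζ₆)) via
SteinbergChain, landing on the same ray reps as SmythCalibration. Two Mahler measures of different
curves related by an explicit K₂ witness — the sector's cleanest non-CM-free test. [difficulty: L]
[Boyd2002Hyperbolic, BoydRodriguezVillegas2005, Smyth1981]
#9 JensenIsScissors (support) — the sharper form of crux 3 recorded by the planner's chain: every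
JensenMove instance already lies in the subgroup generated by rules (1a), (1b), (2) ALONE — Jensen's
formula is scissors-and-dilation, no Newton–Leibniz/Stokes is used (doubling + radial constancy +
inversion are all changes of variables and additivity). Implies JensenMove (closure_mono, checked in
Sketch.lean); filed as support so that a failure of the NL-free chain does not block the route.
[difficulty: L] [Jensen1899, MckeeSmyth2021, KontsevichZagier2001]

TWO-LAYER PLAN. Foreseen glued splits (none filed now; k ≤ 3, depth 1): SteinbergChain ⇐ ConeStokes
(zero-bulk Stokes for the pulled-back unfolded η on
the (s,t)-rectangle, apex cell included) → RayMatching (the t = a, b edges ARE the ray reps after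
u-refolding) → SteinbergChain;
JensenMove ⇐ JensenDoubling (2[J(α)] ~ [J(α²)], all α) → RadialConstancy ([J(ρe^{iψ})] ~
[J(ρ²e^{2iψ})] for |α| < 1 via the fibrewise
dilation) → JensenMove (with the inversion step for |α| > 1 in the glue); BoydLalinExercise ⇐
TorusToDeninger (JensenMove instances for
P₅, P₁₆, P₁, P_{−3i}) → FunctionalEquations (KO/LR identities as sheet-transfer chains) →
DiamondLift (a finite Steinberg witness for
10(P) ~ 12(P+Q) on E_{2(h+1/h)}, h = 1/2) → BoydLalinExercise; SmythCalibration ⇐ JensenSmyth →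
ArcToRays → SmythCalibration.

KILL CRITERIA. SteinbergChain refuted AS TYPED by a side-condition defect (apex/corner
integrability) ⇒ restate with rays rooted at the regular point
w = −1 (two-term ray reps), not a kill; refuted for a clean arc (values certified equal) ⇒ the fixed
calculus misses a planar Stokes
instance for log-forms: close `refuted:SteinbergChain`, report to the operator as a calculus defect
and hand the pair to route Neg — the
whole weight-2 mixed sector (this route, hyperbolic-bloch-sector, scissors-avatars) then needs the
transcendental primitive D and dies
together. JensenMove refuted as typed ⇒ restate with h bounded / τ compact (the wild-weight regime
is the only doubt); refuted for constant
α ⇒ summit refuted in dimension 2 (ClausenPiVanishes is the rational witness pair) — escalate.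
BoydLalinExercise: a proof that NO finite
Steinberg witness exists in K₂(ℚ̄(E₅))⊗ℚ for Lalín's relation does not refute the item (other chains
may exist) but demotes it to
'open-problem' and is itself news (KZ's 'accessible' claim rests on an infinite identity); two
regulator periods equal as numbers with
symbols independent in K₂(C)⊗ℚ would contradict Beilinson rank one — record, do not close.
SymbolKernel refuted ⇒ summit false.
LowDimension/LiouvilleUnfolding proving KZKernelConjecture outright moots the target, not the engine
items.

NOT DECOMPOSED YET. General EtaStokes (zero-bulk Stokes for unfolded η(f,g), arbitrary
holomorphic-algebraic f, g and semialgebraic 2-chains; SteinbergChain is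
its (w,1−w)-on-a-cone instance) and the residue/tame-symbol terms of card S5; the SteinbergTransfer
THEOREM (K₂-witness N·x∧y = φ*(x′∧y′)
+ Σ fₖ∧(1−fₖ) + Σ cₗ∧gₗ plus a rational cycle relation ⇒ move chain) as one typed statement — needs
the definitions below and Λ²-bookkeeping
in FormalRep; the sector form of Conjecture 1 = RegulatorInjectivity (Σ nᵢR(fᵢ,gᵢ;γᵢ) = 0 ⇒ Σ
nᵢ{fᵢ,gᵢ}⊗[γᵢ] = 0 mod S1–S5; Beilinson/Bloch
strength, Mathlib has no Milnor K₂ of function fields); the GENUS-0 SUB-SECTOR (Milnor–Tate: every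
symbol on ℙ¹_ℚ̄ is a sum of {t−a,t−b}
and constants, so every regulator period on ℙ¹ is a chain to ray reps at algebraic points + Baker
terms — the first unconditional
completeness-type corollary, to be filed as a crux once SteinbergChain lands); corners (arcs ending
AT 0 or 1: Clausen arcs, D(e^{iθ}) =
−∫₀^θ log|1−e^{iφ}|dφ) as a support restatement; Boyd's genus-1 corpus (Boyd1998 tables; kit witness
search of card N4) and the
A-polynomial corpus beyond 4₁ (BoydRodriguezVillegas2005); the isogeny rule S4 is route
MultivaluedCoV's SheetTransfer (stmt-2877, shared,
not re-filed); logarithmic Mahler measures in ≥ 3 variables (m(1+x+y+z) = 7ζ(3)/2π²: weight 3, other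
sector).

CHEAPEST FALSIFIER. (i) JensenMove by hand at n = 0, α = 1/2: write the ≈ 10 moves of doubling +
radial constancy against KZCalculus.lean's exact side
conditions (InjOn/HasFDerivWithinAt of (r,t) ↦ (r,(1+r)t/(1−r)) on (1/4,1/2)×ℝ, the cells r ≷
(1−t²)/(1+t²), integrability of (1/r)/(1+t²)
there); any hidden ½ or limit kills the plan of cruxes 3/9 (planner's paper check: none; numerics
J(0.3) = −3e−15, J(2) − 2π log 2 = −4e−14).
(ii) SteinbergChain on the simplest arc, the unit circle from ζ₆ to i (cone = sector avoiding 1,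
log|w| ≡ 0 so r₁ ≡ 0): the claim is
'Clausen arc rep ~ difference of two ray reps'; run the cone Stokes on paper and locate the apex
cell — if it needs an arctan primitive in s
with no Möbius repair, re-root rank 2 at w = −1 before staffing. (iii) BoydLalinExercise: check (by
hand or kit) whether Lalín's symbols
{f,1−f}, {g,1−g}, {g^σ,1−g^σ} plus torsion-function symbols already yield the 6-vs-11 identity in
Λ²ℚ̄(E)^×⊗ℚ mod constants (finite linear
algebra on divisors supported on E[4] ∪ {A,B}); a certified 'no' at bounded support is first
evidence that KZ's exercise is not finitely
accessible along this line.

NUMBERS. m(1+x+y) = 0.3230659472 (Smyth1981; here 0.32306595); D(e^{iπ/3}) = Cl₂(π/3) = 1.0149416064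
(ray formula here 1.0149410, quadrature);
M(1+x+y) = 4π²m = 4πD = 12.75413; Cl₂(π) = 0 (here −2e−6); m(1) = 0.2513304 = L′(E₁₅,0) (Boyd1998,
Rogers–Zudilin), m(5) = 1.5079826,
m(16) = 2.7646348, m(5)/m(1) = 6.0000, m(16)/m(5) = 1.83333333 (Lalin2010: exactly 6 and 11/6),
m(8)/m(2) = 4.0000 (LalinRogers2007);
vol(4₁) = 2.0298832128, m(A_{4₁}) = 0.6461319 = vol(4₁)/π = 2m(1+x+y) (Boyd2002Hyperbolic; ratio
here 1.9999996). Jensen: J(α) = 2π log⁺|α|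
checked at α = 0.3, 0.5+0.5i, 1, ζ₆, 2, 1.5i. Items at open: 9 (4 cruxes, 1 target, 1 assembly, 3
support). Scripts: folder num/check1.py.

DEFINITION REQUESTS. D1 `KZ.torusLogRep` (a.k.a. mahlerRep): for a Laurent polynomial P ∈
ℚ[x^±,y^±], P ≠ 0, the 3-dim unfolded torus representation
[{(t,s,u) : u between 1 and |P(e(t),e(s))|²}, ±2/((1+t²)(1+s²)u)] as a `KZ.IntegralRep 3`
(obligations: ℚ-semialgebraicity; absolute
integrability = integrability of log|P| on T², a theorem), value 4π²·m(P) — topic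
Summits/KontsevichZagierPeriods/KontsevichZagierPeriods/Theorems,
for SmythCalibration/BoydLalinExercise/FigureEightIsTwoSmyth and the Boyd corpus. D2 `KZ.rayDilogRep
(p q : ℝ)` (p, q real algebraic,
(p,q) ∉ {0} ∪ [1,∞)×{0}): the 2-dim ray representation of D(p+iq) used in SteinbergChain, with value
lemma = Zagier's integral — same topic.
D3 (later, with SteinbergTransfer) `KZ.regulatorRep` for (C, f, g, γ). Cite facts wanted: none now
(Smyth1981, Lalin2010, Boyd2002Hyperbolic
value identities enter only as certified equalities of specific reps; if a prover needs them as
hypotheses they become `fact:` cites then).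

Novelty: Searches (2026-08-15): `ledger idea list --problem KontsevichZagierPeriods` (123 cards: twin
k-theory-steinberg-certificates-mahler RETIRED as
superseded by this card with salvage 'Smyth first, genus 0, Mellit/Brunault';
hyperbolic-bloch-sector open, unrouted); grep of all 9 route files
of the sub for Mahler|Steinberg|K₂|regulator|Jensen|Boyd|dilogarithm (only MultivaluedCoV, which
defers 'KZ's Mahler 16-vs-5 exercise' to this
card and supplies S4); `ledger negatives` (0); `lit frontier KontsevichZagierPeriods --since 2020`
(30 rows, none on Mahler/regulators inside
the rules); `lit search --hybrid "Mahler measure dilogarithm Jensen formula Bloch Wigner Smyth"` (10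
held docs; nearest MckeeSmyth2021 ch. 1–2,
READ pp. 6, 39–44: Ex. 1.11 Jensen, Thm 2.36/Cor 2.38 dilogarithm formula, Prop 2.42/Ex 2.43 Smyth,
(2.23) r₅ = 6, r₁₆ = 11); KZ2001
(paper:url-4812d7ce6862) READ pp. 5, 9, 25; `lit read arxiv:0908.1435` (Lalin2010, READ in full:
functional equations, r = D_E∘◇, torsion
diamond relation 10(P) ~ 12(P+Q)); crossref/zbmath lookups resolving Boyd1998, Deninger1997,
RodriguezVillegas1999, BoydRodriguezVillegas2002,
Smyth1981, Brunault2008, Brunault2015, Bloch2011, doi:10.1142/s1793042110003174; `lit galaxy search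
… --star all` ×3 and lit searchd FTS:
unavailable/timeouts this hour (logged in NOTES.md); the card's own audit (refuter-novelty-9:
new-combination) and the twin's audit
(refuter-novelty-10) read.
Nearest prior art found: KontsevichZagier2001 p. 9 (poses the 16-vs-5 id  [refs: 10.1142/s1793042110003174, 0908.1435, paper:url-4812d7ce6862, arxiv:0908.1435, doi:10.1142/s1793042110003174, MckeeSmyth2021, Lalin2010, Boyd1998, Deninger1997, RodriguezVillegas1999, BoydRodriguezVillegas2002, Smyth1981, Brunault2008, Brunault2015, Bloch2011, KontsevichZagier2001]

Barriers (technique_class: k2-symbol-transfer, regulator-stokes, unfolded-logarithm): - technique_class: k2-symbol-transfer, regulator-stokes, unfolded-logarithm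
- Literature.Barriers.KontsevichZagierPeriods.noSemialgebraicPrimitive_inv_sub_two: evaded by
construction — the sector is made of logarithms and dilogarithms, the textbook casualties, but no
item uses log|f| or D(w) as a rule-3 primitive: log is unfolded into the fibre {u between 1 and
|f|²} with integrand 1/u, D enters only through the closed algebraic-coefficient form η(w,1−w) and
its ray REPRESENTATION ρ(z); JensenMove/JensenIsScissors use no Newton–Leibniz at all;
SteinbergChain's Stokes runs along coordinates with semialgebraic primitives (coef/u) on CAD cells —
its why-might-fail names exactly the cell where a transcendental (arctan) primitive would sneak in.
- Literature.Barriers.KontsevichZagierPeriods.kzConjecture_implies_oddZetaAlgIndep: applies verbatim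
to the target SymbolKernel only (summit-strength, admitted); the cruxes and supports assert
derivability of VANISHING combinations already known to vanish (Jensen, η exact, Smyth, Lalín, Boyd)
and prove no number irrational.
- Literature.Barriers.KontsevichZagierPeriods.kzConjecture_implies_twoPiI_log_algIndep: same — only
SymbolKernel inherits it; note the engine never separates π from logs (both sides of every item
carry the same power of π by construction: torus reps vs (∫dt/(1+t²)) ⊗ ray reps).
- Literature.Barriers.KontsevichZagierPeriods.kzConjecture_implies_ellipticPeriods_algIndep: same —
only SymbolKernel; BoydLalinExercise compare

Novelty grade: new-combination — Refuter grade (route-review gen-2). Searches: lit s2 "Mahler measure periods Kontsevich Zagier conjecture" (13 rows: Cresson-Viu-Sos jtnb.1204, Viu-Sos 1509.01097, Ayoub, Zhou, Guillera-Rogers, Hormann; none derives Jensen/Mahler/regulator identities inside the rules); crossref "Lalin conjecture Boy (refuter refuter-rreview-route-KontsevichZagierPe-a67fb1ee-g2-0, 2026-08-15T14:17:28Z; prior: KontsevichZagier2001, arxiv:1509.01097, doi:10.5802/jtnb.1204, doi:10.1215/s0012-7094-07-13832-8, Deninger1997, RodriguezVillegas1999, BoydRodriguezVillegas2002, arxiv:math/0612007,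 doi:10.1142/s1793042110003174, doi:10.5802/jtnb.841, Smyth1981, MckeeSmyth2021, Bloch2011)

History (route lifecycle, newest last):
- 2026-08-16T04:08:44Z · AUTO-CRUX (backfill): SymbolKernel — hypotheses of the deciding theorem that nothing in the route derives are cruxes (operator:999:1085951)
- 2026-08-25T03:54:16Z · DORMANT — reconciler: no traction for 7.3 d (last activity item-evidence-added at 2026-08-17T19:00:36Z); parked, not closed — `ledger route dormant route-KontsevichZagier (operator:999:72111)

sub-problem: KontsevichZagierPeriods · status: dormant · opened planner-plancard-KontsevichZagierPeriods-Kont-9261b3a6-0 2026-08-15T11:40:20Z · rev 4 · ledger route-KontsevichZagierPeriods-K2SymbolChains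
GENERATED by the gate from the ledger (D-0016/17). Provers cite these decls: `theorem foo : Summit.KontsevichZagierPeriods.KontsevichZagierPeriods.Theses.K2SymbolChains.<Decl> := …` in Summits/KontsevichZagierPeriods/KontsevichZagierPeriods/Theorems/<Name>.lean.
-/

namespace Summit.KontsevichZagierPeriods.KontsevichZagierPeriods.Theses.K2SymbolChains

open scoped BigOperators Topology Manifold Classical MeasureTheory ProbabilityTheory Matrix InnerProductSpace ComplexConjugate ContinuousMap
open Filter Set Function TopologicalSpace MeasureTheory

attribute [summit_statement] _root_.KontsevichZagierPeriods

open Literature Periods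

/-- item stmt-KontsevichZagierPeriods-5197 · crux (kind.auto-crux: conjecture-grade) · rank 0 · open · by planner
why it might fail: Summit-strength: KZKernelConjecture ⇒ it, and with cruxes 2–3 it ⇒ KZKernelConjecture; the three strength barriers apply verbatim; on the K₂ sector it contains Beilinson-regulator injectivity (Goncharov1999 Conj. 2.8 analogue), wide open.
sources: KontsevichZagier2001, HuberMullerStach2017, Goncharov1999, Bloch2011
[target] kernel conjecture of the SIX-rule calculus KZ ∪ {Jensen rule, Steinberg-chain rule}: every
subgroup R ≥ KZ.relations closed under all JensenMove instances and all SteinbergChain instances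
contains ker KZ.eval (X's open core (K); KZKernelConjecture ⇒ it trivially, proved in Sketch.lean;
with cruxes 2–3 it ⇒ KZKernelConjecture = the Assembly). -/
@[route_item "route-KontsevichZagierPeriods-K2SymbolChains", crux]
def SymbolKernel : Prop :=
  ∀ (R : AddSubgroup Literature.NumberTheory.Transcendental.KZ.FormalRep), Literature.NumberTheory.Transcendental.KZ.relations ≤ R → (∀ (n : ℕ) (τ : Set (Fin n → ℝ)) (h α₁ α₂ : (Fin n → ℝ) → ℝ) (r r' : Literature.NumberTheory.Transcendental.KZ.IntegralRep (n + 2)), Literature.ModelTheory.ExponentialFields.IsSemialgebraic ℚ τ → Literature.NumberTheory.Transcendental.IsSemialgebraicFunOn ℚ τ h → Literature.NumberTheory.Transcendental.IsSemialgebraicFunOn ℚ τ α₁ → Literature.NumberTheory.Transcendental.IsSemialgebraicFunOn ℚ τ α₂ → MeasureTheory.IntegrableOn (fun x => h x * (1 + |Real.log (α₁ x ^ 2 + α₂ x ^ 2)|)) τ → r.domain = {w | (fun i : Fin n => w (Fin.castAdd 2 i)) ∈ τ ∧ ((1 < w (Fin.natAdd n 1) ∧ w (Fin.natAdd n 1)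 < (((1 - w (Fin.natAdd n 0) ^ 2) / (1 + w (Fin.natAdd n 0) ^ 2) - α₁ (fun i : Fin n => w (Fin.castAdd 2 i))) ^ 2 + (2 * w (Fin.natAdd n 0) / (1 + w (Fin.natAdd n 0) ^ 2) - α₂ (fun i : Fin n => w (Fin.castAdd 2 i))) ^ 2)) ∨ ((((1 - w (Fin.natAdd n 0) ^ 2) / (1 + w (Fin.natAdd n 0) ^ 2) - α₁ (fun i : Fin n => w (Fin.castAdd 2 i))) ^ 2 + (2 * w (Fin.natAdd n 0) / (1 + w (Fin.natAdd n 0) ^ 2) - α₂ (fun i : Fin n => w (Fin.castAdd 2 i))) ^ 2) < w (Fin.natAdd n 1) ∧ w (Fin.natAdd n 1) < 1))} → (∀ w ∈ r.domain, r.integrand w = (if 1 < w (Fin.natAdd n 1) then (1:ℝ) else -1) * h (fun i : Fin n => w (Fin.castAdd 2 i)) / ((1 + w (Fin.natAdd n 0) ^ 2) * w (Fin.natAdd n 1))) → r'.domain = {w | (fun i : Fin n => w (Fin.castAdd 2 i)) ∈ τ ∧ 1 < w (Fin.natAdd n 1) ∧ w (Fin.natAdd n 1) < α₁ (fun i : Fin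 n => w (Fin.castAdd 2 i)) ^ 2 + α₂ (fun i : Fin n => w (Fin.castAdd 2 i)) ^ 2} → (∀ w ∈ r'.domain, r'.integrand w = h (fun i : Fin n => w (Fin.castAdd 2 i)) / ((1 + w (Fin.natAdd n 0) ^ 2) * w (Fin.natAdd n 1))) → Literature.NumberTheory.Transcendental.KZ.of r - Literature.NumberTheory.Transcendental.KZ.of r' ∈ R) → (∀ (a b : ℝ) (γ₁ γ₂ γ₁' γ₂' : ℝ → ℝ) (r₁ r₂ ρa ρb : Literature.NumberTheory.Transcendental.KZ.IntegralRep 2), a < b → Literature.NumberTheory.Transcendental.IsSemialgebraicFunOn ℚ {x : Fin 1 → ℝ | a < x 0 ∧ x 0 < b} (fun x => γ₁ (x 0)) → Literature.NumberTheory.Transcendental.IsSemialgebraicFunOn ℚ {x : Fin 1 → ℝ | a < x 0 ∧ x 0 < b} (fun x => γ₂ (x 0)) → ContinuousOn γ₁ (Set.Icc a b) → ContinuousOn γ₂ (Set.Icc a b) → (∀ t ∈ Set.Ioo a b, HasDerivAt γ₁ (γ₁' t) t ∧ HasDerivAt γ₂ (γ₂' t) t) → (∀ t ∈ Set.Icc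 a b, γ₁ t ^ 2 + γ₂ t ^ 2 ≠ 0 ∧ (γ₂ t ≠ 0 ∨ γ₁ t < 1)) → r₁.domain = {w | a < w 0 ∧ w 0 < b ∧ ((1 < w 1 ∧ w 1 < (γ₁ (w 0) ^ 2 + γ₂ (w 0) ^ 2)) ∨ ((γ₁ (w 0) ^ 2 + γ₂ (w 0) ^ 2) < w 1 ∧ w 1 < 1))} → (∀ w ∈ r₁.domain, r₁.integrand w = (if 1 < w 1 then (1:ℝ) else -1) * ((-(1 - γ₁ (w 0)) * γ₂' (w 0) - γ₂ (w 0) * γ₁' (w 0)) / ((1 - γ₁ (w 0)) ^ 2 + γ₂ (w 0) ^ 2)) / (2 * w 1)) → r₂.domain = {w | a < w 0 ∧ w 0 < b ∧ ((1 < w 1 ∧ w 1 < ((1 - γ₁ (w 0)) ^ 2 + γ₂ (w 0) ^ 2)) ∨ (((1 - γ₁ (w 0)) ^ 2 + γ₂ (w 0) ^ 2) < w 1 ∧ w 1 < 1))} → (∀ w ∈ r₂.domain, r₂.integrand w = (if 1 < w 1 then (1:ℝ) else -1) * ((γ₁ (w 0) * γ₂' (w 0) - γ₂ (w 0) * γ₁'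 (w 0)) / (γ₁ (w 0) ^ 2 + γ₂ (w 0) ^ 2)) / (2 * w 1)) → ρa.domain = {w | 0 < w 0 ∧ w 0 < 1 ∧ ((1 < w 1 ∧ w 1 < w 0 ^ 2 * (γ₁ a ^ 2 + γ₂ a ^ 2)) ∨ (w 0 ^ 2 * (γ₁ a ^ 2 + γ₂ a ^ 2) < w 1 ∧ w 1 < 1))} → (∀ w ∈ ρa.domain, ρa.integrand w = (if 1 < w 1 then (1:ℝ) else -1) * (-(γ₂ a)) / (2 * w 1 * ((1 - w 0 * (γ₁ a)) ^ 2 + (w 0 * (γ₂ a)) ^ 2))) → ρb.domain = {w | 0 < w 0 ∧ w 0 < 1 ∧ ((1 < w 1 ∧ w 1 < w 0 ^ 2 * (γ₁ b ^ 2 + γ₂ b ^ 2)) ∨ (w 0 ^ 2 * (γ₁ b ^ 2 + γ₂ b ^ 2) < w 1 ∧ w 1 < 1))} → (∀ w ∈ ρb.domain, ρb.integrand w = (if 1 < w 1 then (1:ℝ) else -1) * (-(γ₂ b)) / (2 * w 1 * ((1 - w 0 * (γ₁ b)) ^ 2 + (w 0 * (γ₂ b)) ^ 2))) → Literature.NumberTheory.Transcendental.KZ.of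 r₁ - Literature.NumberTheory.Transcendental.KZ.of r₂ - Literature.NumberTheory.Transcendental.KZ.of ρb + Literature.NumberTheory.Transcendental.KZ.of ρa ∈ R) → ∀ c : Literature.NumberTheory.Transcendental.KZ.FormalRep, Literature.NumberTheory.Transcendental.KZ.eval c = 0 → c ∈ R

/-- item stmt-KontsevichZagierPeriods-5198 · crux · rank 2 · open · by planner
why it might fail: Apex w=0 is a puncture of η(w,1−w) and Newton–Leibniz along the ray parameter has arctan primitives, so the zero-bulk Stokes must run along u or t on CAD cells of the unfolded cone; a cell reaching u→0 can break rule 3's closed-fibre continuity or absolute integrability.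
sources: Bloch2011, Zagier2007Dilogarithm, BoydRodriguezVillegas2002, KontsevichZagier2001, BochnakCosteRoy1998
[crux] STEINBERG IS A CHAIN (card S3). For a < b and a ℚ-semialgebraic arc γ = (γ₁,γ₂) on [a,b],
continuous, differentiable inside, with γ(t) ≠ 0 and the segment [0,γ(t)] avoiding w = 1 for all t ∈
[a,b]: the two unfolded 2-dim representations r₁ = [{a<t<b, u between 1 and |γ|²}, ±(d/dt
arg(1−γ))/(2u)] (= ∫ log|w| d arg(1−w)) and r₂ = [{a<t<b, u between 1 and |1−γ|²}, ±(d/dt arg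
γ)/(2u)] (= ∫ log|1−w| d arg w), and the ray representations ρ(z) = [{0<s<1, u between 1 and
s²|z|²}, ∓q/(2u|1−sz|²)] of the Bloch–Wigner dilogarithm D(z) (z = p+iq; value D(z), ray formula
certified numerically) at z = γ(a), γ(b), satisfy of r₁ − of r₂ − of ρ(γ(b)) + of ρ(γ(a)) ∈
KZ.relations. Value identity: ∫_γ η(w,1−w) = D(γ(b)) − D(γ(a)) (η(w,1−w) = dD exact on ℂ∖{0,1}).
Intended chain: zero-bulk Stokes for the pull-back of the unfolded η under (s,t) ↦ s·γ(t) on the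
rectangle (0,1)×(a,b) (the cone), by cylindrical decomposition with Newton–Leibniz along t/u and
change of variables u = |sγ|², |1−sγ|² on monotonicity cells; edges s = 1 (the arc), t = a, b (the
rays), s → 0 (degenerate, integrable apex). [difficulty: L] -/
@[route_item "route-KontsevichZagierPeriods-K2SymbolChains", crux]
def SteinbergChain : Prop :=
  ∀ (a b : ℝ) (γ₁ γ₂ γ₁' γ₂' : ℝ → ℝ) (r₁ r₂ ρa ρb : Literature.NumberTheory.Transcendental.KZ.IntegralRep 2), a < b → Literature.NumberTheory.Transcendental.IsSemialgebraicFunOn ℚ {x : Fin 1 → ℝ | a < x 0 ∧ x 0 < b} (fun x => γ₁ (x 0)) → Literature.NumberTheory.Transcendental.IsSemialgebraicFunOn ℚ {x : Fin 1 → ℝ | a < x 0 ∧ x 0 < b} (fun x => γ₂ (x 0)) → ContinuousOn γ₁ (Set.Icc a b) → ContinuousOn γ₂ (Set.Icc a b) → (∀ t ∈ Set.Ioo a b, HasDerivAt γ₁ (γ₁' t) t ∧ HasDerivAt γ₂ (γ₂' t) t) → (∀ t ∈ Set.Icc a b, γ₁ t ^ 2 + γ₂ t ^ 2 ≠ 0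 ∧ (γ₂ t ≠ 0 ∨ γ₁ t < 1)) → r₁.domain = {w | a < w 0 ∧ w 0 < b ∧ ((1 < w 1 ∧ w 1 < (γ₁ (w 0) ^ 2 + γ₂ (w 0) ^ 2)) ∨ ((γ₁ (w 0) ^ 2 + γ₂ (w 0) ^ 2) < w 1 ∧ w 1 < 1))} → (∀ w ∈ r₁.domain, r₁.integrand w = (if 1 < w 1 then (1:ℝ) else -1) * ((-(1 - γ₁ (w 0)) * γ₂' (w 0) - γ₂ (w 0) * γ₁' (w 0)) / ((1 - γ₁ (w 0)) ^ 2 + γ₂ (w 0) ^ 2)) / (2 * w 1)) → r₂.domain = {w | a < w 0 ∧ w 0 < b ∧ ((1 < w 1 ∧ w 1 < ((1 - γ₁ (w 0)) ^ 2 + γ₂ (w 0) ^ 2)) ∨ (((1 - γ₁ (w 0)) ^ 2 + γ₂ (w 0) ^ 2) < w 1 ∧ w 1 < 1))} → (∀ w ∈ r₂.domain, r₂.integrand w = (if 1 < w 1 then (1:ℝ) else -1) * ((γ₁ (w 0) * γ₂' (w 0) - γ₂ (w 0) * γ₁' (w 0)) / (γ₁ (w 0) ^ 2 + γ₂ (w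 0) ^ 2)) / (2 * w 1)) → ρa.domain = {w | 0 < w 0 ∧ w 0 < 1 ∧ ((1 < w 1 ∧ w 1 < w 0 ^ 2 * (γ₁ a ^ 2 + γ₂ a ^ 2)) ∨ (w 0 ^ 2 * (γ₁ a ^ 2 + γ₂ a ^ 2) < w 1 ∧ w 1 < 1))} → (∀ w ∈ ρa.domain, ρa.integrand w = (if 1 < w 1 then (1:ℝ) else -1) * (-(γ₂ a)) / (2 * w 1 * ((1 - w 0 * (γ₁ a)) ^ 2 + (w 0 * (γ₂ a)) ^ 2))) → ρb.domain = {w | 0 < w 0 ∧ w 0 < 1 ∧ ((1 < w 1 ∧ w 1 < w 0 ^ 2 * (γ₁ b ^ 2 + γ₂ b ^ 2)) ∨ (w 0 ^ 2 * (γ₁ b ^ 2 + γ₂ b ^ 2) < w 1 ∧ w 1 < 1))} → (∀ w ∈ ρb.domain, ρb.integrand w = (if 1 < w 1 then (1:ℝ) else -1) * (-(γ₂ b)) / (2 * w 1 * ((1 - w 0 * (γ₁ b)) ^ 2 + (w 0 * (γ₂ b)) ^ 2))) → Literature.NumberTheory.Transcendental.KZ.of r₁ - Literature.NumberTheory.Transcendental.KZ.of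 r₂ - Literature.NumberTheory.Transcendental.KZ.of ρb + Literature.NumberTheory.Transcendental.KZ.of ρa ∈ Literature.NumberTheory.Transcendental.KZ.relations

/-- item stmt-KontsevichZagierPeriods-5199 · crux · rank 3 · closed · proved by Summit.KontsevichZagierPeriods.K2SymbolChains.jensenMove_proof @ b2b1ad834f60 (prover) · by planner
why it might fail: No division, no limits: the ρ^{2^n}→0, mean-value (log = Green primitive) and residue proofs are NOT chains; the finite chain (doubling 2J(α)~J(α²) + radial constancy by the fibrewise dilation t↦(1+r)t/(1−r)) needs C¹ cells for discontinuous semialgebraic α,h (BCR CAD, not in tree).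
sources: Jensen1899, MckeeSmyth2021, Deninger1997, KontsevichZagier2001, BochnakCosteRoy1998
[crux] JENSEN IS A MOVE (card: 'Jensen = Stokes', fibrewise). Over any ℚ-semialgebraic base τ ⊆ ℝⁿ
with semialgebraic weight h and centre α = α₁ + iα₂ on τ (weight integrable against 1 + |log|α|²|):
the (n+2)-dim representation r = [{x ∈ τ, s ∈ ℝ, u between 1 and W}, ±h(x)/((1+s²)u)], W = |e(s) −
α(x)|², e(s) = ((1−s²)+2is)/(1+s²) (value ∫_τ h·J(α), J(α) = ∫₀^{2π} log|e^{iφ}−α|dφ) and r′ = [{x ∈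
τ, |α(x)| > 1, s ∈ ℝ, 1 < u < |α(x)|²}, h(x)/((1+s²)u)] (value ∫_τ h·2π log⁺|α|) satisfy of r − of
r′ ∈ KZ.relations. Paper chain found by the planner (fibrewise, uniform in x): |α|<1: rotation (rule
2, Möbius in s), DOUBLING 2[J(α)] ~ [J(α²)] (log|e−α|+log|e+α| = log|e²−α²|: unfolded S1 = 1a +
dilation, two-sheeted ψ = 2φ = rule 2 twice, shift by π), RADIAL CONSTANCY [J(ρ)] ~ [J(ρ²)] (refold
to the (r,t)-plane rep of ∂_r log W on (ρ²,ρ)×ℝ by u = W(r,t) on the cells r ≷ cos φ; its integrand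
is (1/r)[1/(1+t²) − c/(1+c²t²)], c = (1+r)/(1−r), and ONE fibrewise dilation (r,t) ↦ (r,ct)
identifies the two summands), hence [J] = 2[J] − [J] ~ [J(ρ²)] − [J(ρ²)]·… ∈ relations with NO
division by 2; |α| = 1: doubling alone; |α| > 1: unfolded S1 splits off log|α|² → r′ and inversion φ
↦ −φ. [difficulty -/
@[route_item "route-KontsevichZagierPeriods-K2SymbolChains", crux]
def JensenMove : Prop :=
  ∀ (n : ℕ) (τ : Set (Fin n → ℝ)) (h α₁ α₂ : (Fin n → ℝ) → ℝ) (r r' : Literature.NumberTheory.Transcendental.KZ.IntegralRep (n + 2)), Literature.ModelTheory.ExponentialFields.IsSemialgebraic ℚ τ → Literature.NumberTheory.Transcendental.IsSemialgebraicFunOn ℚ τ h → Literature.NumberTheory.Transcendental.IsSemialgebraicFunOn ℚ τ α₁ → Literature.NumberTheory.Transcendental.IsSemialgebraicFunOn ℚ τ α₂ → MeasureTheory.IntegrableOn (fun x => h x * (1 + |Real.log (α₁ x ^ 2 + α₂ x ^ 2)|)) τ → r.domain = {w | (fun i : Fin n => w (Fin.castAdd 2 i)) ∈ τ ∧ ((1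 < w (Fin.natAdd n 1) ∧ w (Fin.natAdd n 1) < (((1 - w (Fin.natAdd n 0) ^ 2) / (1 + w (Fin.natAdd n 0) ^ 2) - α₁ (fun i : Fin n => w (Fin.castAdd 2 i))) ^ 2 + (2 * w (Fin.natAdd n 0) / (1 + w (Fin.natAdd n 0) ^ 2) - α₂ (fun i : Fin n => w (Fin.castAdd 2 i))) ^ 2)) ∨ ((((1 - w (Fin.natAdd n 0) ^ 2) / (1 + w (Fin.natAdd n 0) ^ 2) - α₁ (fun i : Fin n => w (Fin.castAdd 2 i))) ^ 2 + (2 * w (Fin.natAdd n 0) / (1 + w (Fin.natAdd n 0) ^ 2) - α₂ (fun i : Fin n => w (Fin.castAdd 2 i))) ^ 2) < w (Fin.natAdd n 1) ∧ w (Fin.natAdd n 1) < 1))} → (∀ w ∈ r.domain, r.integrand w = (if 1 < w (Fin.natAdd n 1) then (1:ℝ) else -1) * h (fun i : Fin n => w (Fin.castAdd 2 i)) / ((1 + w (Fin.natAdd n 0) ^ 2) * w (Fin.natAdd n 1))) → r'.domain = {w | (fun i : Fin n => w (Fin.castAdd 2 i)) ∈ τ ∧ 1 < w (Fin.natAdd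 n 1) ∧ w (Fin.natAdd n 1) < α₁ (fun i : Fin n => w (Fin.castAdd 2 i)) ^ 2 + α₂ (fun i : Fin n => w (Fin.castAdd 2 i)) ^ 2} → (∀ w ∈ r'.domain, r'.integrand w = h (fun i : Fin n => w (Fin.castAdd 2 i)) / ((1 + w (Fin.natAdd n 0) ^ 2) * w (Fin.natAdd n 1))) → Literature.NumberTheory.Transcendental.KZ.of r - Literature.NumberTheory.Transcendental.KZ.of r' ∈ Literature.NumberTheory.Transcendental.KZ.relations

/-- item stmt-KontsevichZagierPeriods-5200 · crux · rank 4 · open · by planner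
why it might fail: Values: Smyth 1981 (re-certified here to 1e−6), so a failure is the SUMMIT failing on a 3-dim pair; as typed the risk is the unit-circle arc through w=−1 (vertical tangent) and the endpoint rays at ζ₆^{±1}: every intermediate rep must stay absolutely integrable.
sources: Smyth1981, MckeeSmyth2021, BoydRodriguezVillegas2002, RodriguezVillegas1999
[crux] SMYTH'S FORMULA AS A CHAIN (first Lean calibration of the sector, salvaged from the retired
twin card): the unfolded torus representation of M(1+x+y) := ∫∫ log|1 + e^{iθ} + e^{iφ}| dθdφ =
4π²·m(1+x+y) (3-dim: t,s rational circle parameters, u the unfolded log, integrand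
±2/((1+t²)(1+s²)u)) is KZ-equivalent to the 3-dim representation [ℝ_t × {0<s<1, s²<u<1},
√3/((1+t²)·u·(1−s+s²))] = (∫dt/(1+t²)) ⊗ 2·2ρ(ζ₆) of 4π·D(e^{iπ/3}); values 12.754… agree
(Smyth1981: m(1+x+y) = L′(χ₋₃,−1) = D(e^{iπ/3})/π; MckeeSmyth2021 Prop. 2.42, Ex. 2.43). Predicted
chain: JensenMove in φ with α(t) = −(1+x(t)) (Deninger cycle = arc |θ| < 2π/3), then {x,−1−x}: w =
−x turns η(x,1+x) into η(w,1−w) = dD along the unit-circle arc from ζ₆⁻¹ to ζ₆ through −1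
(SteinbergChain on two sub-arcs, cone = unit sector avoiding 1), and ρ(z̄) = −ρ(z) (rule 1b). [deps:
JensenMove, SteinbergChain] [difficulty: M] -/
@[route_item "route-KontsevichZagierPeriods-K2SymbolChains"]
def SmythCalibration : Prop :=
  ∀ (r r' : Literature.NumberTheory.Transcendental.KZ.IntegralRep 3), r.domain = {w | (1 < w 2 ∧ w 2 < ((1 + (1 - w 0 ^ 2) / (1 + w 0 ^ 2) + (1 - w 1 ^ 2) / (1 + w 1 ^ 2)) ^ 2 + (2 * w 0 / (1 + w 0 ^ 2) + 2 * w 1 / (1 + w 1 ^ 2)) ^ 2)) ∨ (((1 + (1 - w 0 ^ 2) / (1 + w 0 ^ 2) + (1 - w 1 ^ 2) / (1 + w 1 ^ 2)) ^ 2 + (2 * w 0 / (1 + w 0 ^ 2) + 2 * w 1 / (1 + w 1 ^ 2)) ^ 2) < w 2 ∧ w 2 < 1)} → Set.EqOn r.integrand (fun w => (if 1 < w 2 then (1:ℝ) else -1) * 2 / ((1 + w 0 ^ 2) * (1 + w 1 ^ 2) * w 2)) r.domain → r'.domain = {w | 0 < w 1 ∧ w 1 < 1 ∧ w 1 ^ 2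 < w 2 ∧ w 2 < 1} → Set.EqOn r'.integrand (fun w => Real.sqrt 3 / ((1 + w 0 ^ 2) * w 2 * (1 - w 1 + w 1 ^ 2))) r'.domain → Literature.NumberTheory.Transcendental.KZ.Equivalent r r'

/-- item stmt-KontsevichZagierPeriods-5201 · crux · rank 5 · open · by planner
why it might fail: Lalín's proof runs through Bloch's elliptic dilogarithm (r = D_E∘◇, a Kronecker–Eisenstein series), not a finite symbol identity; a chain needs an unpublished lift of the torsion-supported diamond relation 10(P)~12(P+Q) to Λ²ℚ̄(E)^×⊗ℚ mod Steinberg+constants, else KZ's 'accessible identity' is open.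
sources: KontsevichZagier2001, Lalin2010, LalinRogers2007, Boyd1998, RodriguezVillegas1999, Brunault2008
[crux] KZ'S OWN EXERCISE (KontsevichZagier2001 §1.2 p. 9: 'the reader may like to try proving the
accessible identity μ(x+y+16+1/x+1/y) = (11/6)·μ(x+y+5+1/x+1/y) using only the rules 1)–3)'). On the
torus P_k = x+1/x+y+1/y+k = 2cos θ + 2cos φ + k is REAL and ≥ 1 for k = 5, 16, so the unfolded torus
representations are literally of KZ's rational shape: r = [{1 < u < (2c(t)+2c(s)+16)²},
12/((1+t²)(1+s²)u)], r′ = [{1 < u < (2c(t)+2c(s)+5)²}, 22/((1+t²)(1+s²)u)], c(t) = (1−t²)/(1+t²),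
with values 6·4π²m(16) = 11·4π²m(5) (Lalin2010: m(16) = (11/6)m(5) = 11m(1); ratio re-certified here
to 1e−13). Claim: KZ.Equivalent r r′ — an instance of the summit's hypothesis (both IsRational;
summit ⇒ item checked in Sketch.lean). Predicted chain: JensenMove twice per side (roots y_±(θ) real
algebraic), functional equations m(1)+m(16) = 2m(5), m(5)+m(−3i) = m(16) (Kurokawa–Ochiai /
LalinRogers2007: products + 2-sheeted torus maps = sheet transfer), the twist isomorphism (X,Y) ↦
(−X,iY) as rule 2 on E(ℂ) ⊂ ℝ⁴ read through the cycle, and a FINITE Steinberg witness lifting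
Lalín's diamond relation 10(P) ~ 12(P+Q) (torsion points P, Q, A, B; functions f, g, g^σ) — the open
step. [deps: JensenMove, Steinb -/
@[route_item "route-KontsevichZagierPeriods-K2SymbolChains"]
def BoydLalinExercise : Prop :=
  ∀ (r r' : Literature.NumberTheory.Transcendental.KZ.IntegralRep 3), r.domain = {w | 1 < w 2 ∧ w 2 < (2 * (1 - w 0 ^ 2) / (1 + w 0 ^ 2) + 2 * (1 - w 1 ^ 2) / (1 + w 1 ^ 2) + 16) ^ 2} → Set.EqOn r.integrand (fun w => 12 / ((1 + w 0 ^ 2) * (1 + w 1 ^ 2) * w 2)) r.domain → r'.domain = {w | 1 < w 2 ∧ w 2 < (2 * (1 - w 0 ^ 2) / (1 + w 0 ^ 2) + 2 * (1 - w 1 ^ 2) / (1 + w 1 ^ 2) + 5) ^ 2} → Set.EqOn r'.integrand (fun w => 22 / ((1 + w 0 ^ 2) * (1 + w 1 ^ 2) * w 2)) r'.domain → Literature.NumberTheory.Transcendental.KZ.Equivalent r r'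

/-- item stmt-KontsevichZagierPeriods-17757 · support · rank 6 · closed · proved by Summit.KontsevichZagierPeriods.K2SymbolChains.genericDifferentiability_proof @ b10a37033589 (prover) · by planner
why it might fail: True over ℝ (C¹-cell decomposition), but B must be ℚ-semialgebraic: the tree's exists_contDiffOn_off_small gives an ℝ-semialgebraic exceptional set, so one needs the decomposition over the real closure of ℚ or the differentiability locus as a first-order formula with ℚ-coefficients — not in tree.
sources: BochnakCosteRoy1998, Dries1998, KontsevichZagier2001
[crux] GENERIC DIFFERENTIABILITY OF ℚ-SEMIALGEBRAIC FUNCTIONS (split child 3 of JensenMove; the 'C¹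
cells for discontinuous semialgebraic α, h' of the parent's why-might-fail, typed). For a
ℚ-semialgebraic τ ⊆ ℝⁿ and a ℚ-semialgebraic function f on τ there is a ℚ-semialgebraic B ⊆ τ with
τ∖B Lebesgue-null such that f (as a function on ℝⁿ) is differentiable at every point of B. Intended
proof: U = interior τ is ℚ-semialgebraic (isSemialgebraic_interior) and τ∖U is semialgebraic with
empty interior hence null (Theorems/DefinableMovesNullIffEmptyInterior); on U, f is C¹ off a closed
small semialgebraic Z (Literature exists_contDiffOn_off_small, van den Dries Ch. 7 (3.2)), small ⇒
null; B = U∖Z or the differentiability locus inside U, which must be shown ℚ-semialgebraic.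
[difficulty: M] Why it might fail: True over ℝ (C¹-cell decomposition), but B must be
ℚ-semialgebraic: the tree's exists_contDiffOn_off_small gives an ℝ-semialgebraic exceptional set, so
one needs the decomposition over the real closure of ℚ or the differentiability locus as a
first-order formula with ℚ-coefficients — not in tree. Sources: BochnakCosteRoy1998, Dries1998,
KontsevichZagier2001. (Filed by the crux-strateg -/
@[route_item "route-KontsevichZagierPeriods-K2SymbolChains"]
def GenericDifferentiability : Prop :=
  ∀ (n : ℕ) (τ : Set (Fin n → ℝ)) (f : (Fin n → ℝ) → ℝ), Literature.ModelTheory.ExponentialFields.IsSemialgebraic ℚ τ → Literature.NumberTheory.Transcendental.IsSemialgebraicFunOn ℚ τ f → ∃ B : Set (Fin n → ℝ), B ⊆ τ ∧ Literature.ModelTheory.ExponentialFields.IsSemialgebraic ℚ B ∧ MeasureTheory.volume (τ \ B) = 0 ∧ ∀ x ∈ B, DifferentiableAt ℝ f x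

/-- item stmt-KontsevichZagierPeriods-17758 · support · rank 7 · closed · proved by Summit.KontsevichZagierPeriods.K2SymbolChains.jensenMoveOutside_proof @ ef095b9f8765 (prover) · by planner
why it might fail: The product step splits log W_ρ = log ρ² + log W_{1/ρ} sheet by sheet; where 1 < u lies between ρ²·W_{1/ρ} and ρ² the signed sheets overlap and the bookkeeping needs h·log ρ ∈ L¹ — guaranteed only through the item's weight hypothesis h(1+|log|α|²|) ∈ L¹, which must survive restriction and rotation.
sources: Jensen1899, KontsevichZagier2001, MckeeSmyth2021
[crux] JENSEN OUTSIDE THE CLOSED DISC, SMOOTH CENTRE (split child 2 of JensenMove). Same data as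
JensenMove under the extra hypotheses α₁, α₂ differentiable on τ and |α(x)|² > 1 on τ; conclusion
[r] − [r′] ∈ KZ.relations, r′ the unfolded representation of ∫_τ h·2π log|α| (single sheet 1 < u <
|α|²). Intended chain: rotation_step, then jensen_outside (signed product rule W_ρ = ρ²·W_{1/ρ},
i.e. unfolded additivity log W_ρ = log ρ² + log W_{1/ρ} as rule 1a + a dilation, and Jensen inside
for 1/ρ) — all landed for S ⊇ scissors moves in Theorems/K2SymbolChainsJensenIsScissorsCases.lean;
remaining work = coordinate bridge + integrability extraction as for child 1. [difficulty: M] Why it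
might fail: The product step splits log W_ρ = log ρ² + log W_{1/ρ} sheet by sheet; where 1 < u lies
between ρ²·W_{1/ρ} and ρ² the signed sheets overlap and the bookkeeping needs h·log ρ ∈ L¹ —
guaranteed only through the item's weight hypothesis h(1+|log|α|²|) ∈ L¹, which must survive
restriction and rotation. Sources: Jensen1899, KontsevichZagier2001, MckeeSmyth2021. (Filed by the
crux-strategist as split child of JensenMove = stmt-KontsevichZagierPeriods-5199; assembly
JensenMove_of_subs proved sorry-fr -/
@[route_item "route-KontsevichZagierPeriods-K2SymbolChains"]
def JensenMoveOutside : Prop :=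
  ∀ (n : ℕ) (τ : Set (Fin n → ℝ)) (h α₁ α₂ : (Fin n → ℝ) → ℝ) (r r' : Literature.NumberTheory.Transcendental.KZ.IntegralRep (n + 2)), Literature.ModelTheory.ExponentialFields.IsSemialgebraic ℚ τ → Literature.NumberTheory.Transcendental.IsSemialgebraicFunOn ℚ τ h → Literature.NumberTheory.Transcendental.IsSemialgebraicFunOn ℚ τ α₁ → Literature.NumberTheory.Transcendental.IsSemialgebraicFunOn ℚ τ α₂ → (∀ x ∈ τ, DifferentiableAt ℝ α₁ x ∧ DifferentiableAt ℝ α₂ x) → (∀ x ∈ τ, 1 < α₁ x ^ 2 + α₂ x ^ 2) → MeasureTheory.IntegrableOn (fun x => h x * (1 + |Real.log (α₁ x ^ 2 + α₂ x ^ 2)|)) τ → r.domain = {w | (fun i : Fin n => w (Fin.castAdd 2 i)) ∈ τ ∧ ((1 < w (Fin.natAdd n 1) ∧ w (Fin.natAdd n 1) < (((1 - w (Fin.natAdd n 0) ^ 2) / (1 + w (Fin.natAdd n 0) ^ 2) - α₁ (fun i : Fin n => w (Fin.castAdd 2 i))) ^ 2 + (2 * w (Fin.natAdd n 0) / (1 +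 w (Fin.natAdd n 0) ^ 2) - α₂ (fun i : Fin n => w (Fin.castAdd 2 i))) ^ 2)) ∨ ((((1 - w (Fin.natAdd n 0) ^ 2) / (1 + w (Fin.natAdd n 0) ^ 2) - α₁ (fun i : Fin n => w (Fin.castAdd 2 i))) ^ 2 + (2 * w (Fin.natAdd n 0) / (1 + w (Fin.natAdd n 0) ^ 2) - α₂ (fun i : Fin n => w (Fin.castAdd 2 i))) ^ 2) < w (Fin.natAdd n 1) ∧ w (Fin.natAdd n 1) < 1))} → (∀ w ∈ r.domain, r.integrand w = (if 1 < w (Fin.natAdd n 1) then (1:ℝ) else -1) * h (fun i : Fin n => w (Fin.castAdd 2 i)) / ((1 + w (Fin.natAdd n 0) ^ 2) * w (Fin.natAdd n 1))) → r'.domain = {w | (fun i : Fin n => w (Fin.castAdd 2 i)) ∈ τ ∧ 1 < w (Fin.natAdd n 1) ∧ w (Fin.natAdd n 1) < α₁ (fun i : Fin n => w (Fin.castAdd 2 i)) ^ 2 + α₂ (fun i : Fin n => w (Fin.castAdd 2 i)) ^ 2} → (∀ w ∈ r'.domain, r'.integrand w = h (fun i : Fin n => w (Fin.castAdd 2 i))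 / ((1 + w (Fin.natAdd n 0) ^ 2) * w (Fin.natAdd n 1))) → Literature.NumberTheory.Transcendental.KZ.of r - Literature.NumberTheory.Transcendental.KZ.of r' ∈ Literature.NumberTheory.Transcendental.KZ.relations

/-- item stmt-KontsevichZagierPeriods-17759 · support · rank 8 · closed · proved by Summit.KontsevichZagierPeriods.K2SymbolChains.jensenMoveDisc_proof @ e59459d36037 (prover) · by planner
why it might fail: The landed case lemmas need IntegrableOn h, IntegrableOn (h·log ρ) on the base and DifferentiableAt of ρ=√(α₁²+α₂²); these follow from the hypotheses (α≠0), but the circle regime |α|=1 carries the log-singular fibre: every intermediate doubled/rotated representation must stay absolutely integrable.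
sources: Jensen1899, KontsevichZagier2001, MckeeSmyth2021
[crux] JENSEN ON THE PUNCTURED CLOSED DISC, SMOOTH CENTRE (split child 1 of JensenMove). Same data
as JensenMove (base τ, weight h, centre α = α₁+iα₂, the unfolded torus representation r of ∫_τ
h·J(α)), under the extra hypotheses that α₁, α₂ are differentiable at every point of τ and 0 <
|α(x)|² ≤ 1 on τ; conclusion [r] ∈ KZ.relations (log⁺|α| = 0: the torus average is itself a
relation). Intended chain = the landed engine of Theorems/K2SymbolChainsJensenIsScissors*:
rotation_step (W_α → W_ρ, ρ = |α|, rule 2 by the rational rotation of the circle) then jensen_inside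
(doubling 2[L(ρ)]~[L(ρ²)] + radial constancy, 0<ρ<1) on {|α|<1} and jensen_circle (doubling alone)
on {|α|=1}, bases cut by rule 1a; remaining work is the coordinate bridge to KZ.logUnfoldDomain over
τ×ℝ_s and the extraction of IntegrableOn h, IntegrableOn (h·log ρ) from the item's weight
hypothesis. [difficulty: M] Why it might fail: The landed case lemmas need IntegrableOn h,
IntegrableOn (h·log ρ) on the base and DifferentiableAt of ρ=√(α₁²+α₂²); these follow from the
hypotheses (α≠0), but the circle regime |α|=1 carries the log-singular fibre: every intermediate
doubled/rotated representation must stay absolutely in -/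
@[route_item "route-KontsevichZagierPeriods-K2SymbolChains"]
def JensenMoveDisc : Prop :=
  ∀ (n : ℕ) (τ : Set (Fin n → ℝ)) (h α₁ α₂ : (Fin n → ℝ) → ℝ) (r : Literature.NumberTheory.Transcendental.KZ.IntegralRep (n + 2)), Literature.ModelTheory.ExponentialFields.IsSemialgebraic ℚ τ → Literature.NumberTheory.Transcendental.IsSemialgebraicFunOn ℚ τ h → Literature.NumberTheory.Transcendental.IsSemialgebraicFunOn ℚ τ α₁ → Literature.NumberTheory.Transcendental.IsSemialgebraicFunOn ℚ τ α₂ → (∀ x ∈ τ, DifferentiableAt ℝ α₁ x ∧ DifferentiableAt ℝ α₂ x) → (∀ x ∈ τ, 0 < α₁ x ^ 2 + α₂ x ^ 2 ∧ α₁ x ^ 2 + α₂ x ^ 2 ≤ 1) → MeasureTheory.IntegrableOn (fun x => h x * (1 + |Real.log (α₁ x ^ 2 + α₂ x ^ 2)|)) τ → r.domain = {w | (fun i : Fin n => w (Fin.castAdd 2 i)) ∈ τ ∧ ((1 < w (Fin.natAdd n 1) ∧ w (Fin.natAdd n 1) < (((1 - w (Fin.natAdd n 0) ^ 2) / (1 +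 w (Fin.natAdd n 0) ^ 2) - α₁ (fun i : Fin n => w (Fin.castAdd 2 i))) ^ 2 + (2 * w (Fin.natAdd n 0) / (1 + w (Fin.natAdd n 0) ^ 2) - α₂ (fun i : Fin n => w (Fin.castAdd 2 i))) ^ 2)) ∨ ((((1 - w (Fin.natAdd n 0) ^ 2) / (1 + w (Fin.natAdd n 0) ^ 2) - α₁ (fun i : Fin n => w (Fin.castAdd 2 i))) ^ 2 + (2 * w (Fin.natAdd n 0) / (1 + w (Fin.natAdd n 0) ^ 2) - α₂ (fun i : Fin n => w (Fin.castAdd 2 i))) ^ 2) < w (Fin.natAdd n 1) ∧ w (Fin.natAdd n 1) < 1))} → (∀ w ∈ r.domain, r.integrand w = (if 1 < w (Fin.natAdd n 1) then (1:ℝ) else -1) * h (fun i : Fin n => w (Fin.castAdd 2 i)) / ((1 + w (Fin.natAdd n 0) ^ 2) * w (Fin.natAdd n 1))) → Literature.NumberTheory.Transcendental.KZ.of r ∈ Literature.NumberTheory.Transcendental.KZ.relations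

/-- item stmt-KontsevichZagierPeriods-17791 · support · rank 9 · closed · proved by Summit.KontsevichZagierPeriods.K2SymbolChains.jensenMoveGlue_proof @ 41111289aa13 (prover) · by planner
[support] GLUE of the split of JensenMove (stmt-KontsevichZagierPeriods-5199) into its three
children: JensenMoveDisc → JensenMoveOutside → GenericDifferentiability → JensenMove. PROVED by the
crux-strategist (theorem
Summit.KontsevichZagierPeriods.K2SymbolChains.JensenMoveSplit.JensenMove_of_subs, sorry-free, lean
check rc0, axioms standard; published as Cruxes/JensenMove/Lines/split_disc_outside_generic.lean
@1cc4133c3f57 and attached as evidence on stmt-5199): intersect the smooth loci of α₁, α₂ (child 3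
twice), discard the null remainder of the base and the locus α = 0 (there |e(s) − α|² = 1, empty
fibre), cut the base into the regimes 0 < |α| ≤ 1 / |α| > 1 by rule 1a, apply children 1 and 2, and
note r′ lives over the exterior regime up to a null set. A prover lands the published file verbatim
under Theorems/ and closes this item by `exact JensenMove_of_subs`. [difficulty: provable-now]
Sources: KontsevichZagier2001, Jensen1899. -/
@[route_item "route-KontsevichZagierPeriods-K2SymbolChains"]
def JensenMoveGlue : Prop :=
  JensenMoveDisc → JensenMoveOutside → GenericDifferentiability → JensenMove

/-- item stmt-KontsevichZagierPeriods-5202 · support · rank 9 · closed · proved by Summit.KontsevichZagierPeriods.K2SymbolChains.clausenPiVanishes_proof @ 5f065e5a4037 (prover) · by planner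
sources: MckeeSmyth2021, Zagier2007Dilogarithm, KontsevichZagier2001
[support] Cl₂(π) = ∫₀^π log(2 sin(φ/2)) dφ = 0, i.e. Jensen at |α| = 1, as a GENUINE summit instance
in dimension 2: the rational representations [{1 < u < 4t²/(1+t²)}, 1/((1+t²)u)] and [{4t²/(1+t²) <
u < 1}, 1/((1+t²)u)] (the positive and negative parts of the unfolded ∫ log|1−e^{iφ}| dφ) have equal
values and are KZ-equivalent. Paper chain (planner, 5 moves, NO Newton–Leibniz): doubling —
log|1−e^{iφ}| + log|1+e^{iφ}| = log|1−e^{2iφ}| (unfolded: 1a + dilation u ↦ u/V), shift φ ↦ φ+π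
(Möbius t ↦ −1/t, rule 2), two-sheeted ψ = 2φ (rule 2 on two half-circles + 1b) give 2[J(1)] ~
[J(1)], hence [J(1)] ∈ relations. Cheapest prover warm-up with exactly the cells of JensenMove.
[difficulty: provable-now] -/
@[route_item "route-KontsevichZagierPeriods-K2SymbolChains"]
def ClausenPiVanishes : Prop :=
  ∀ (r r' : Literature.NumberTheory.Transcendental.KZ.IntegralRep 2), r.domain = {w | 1 < w 1 ∧ w 1 < 4 * w 0 ^ 2 / (1 + w 0 ^ 2)} → Set.EqOn r.integrand (fun w => 1 / ((1 + w 0 ^ 2) * w 1)) r.domain → r'.domain = {w | 4 * w 0 ^ 2 / (1 + w 0 ^ 2) < w 1 ∧ w 1 < 1} → Set.EqOn r'.integrand (fun w => 1 / ((1 + w 0 ^ 2) * w 1)) r'.domain → Literature.NumberTheory.Transcendental.KZ.Equivalent r r'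

/-- item stmt-KontsevichZagierPeriods-5203 · support · rank 9 · open · by planner
sources: Boyd2002Hyperbolic, BoydRodriguezVillegas2005, Smyth1981
[support] MAHLER = VOLUME, first instance (card corpus II): for the A-polynomial of the figure-eight
knot A(L,M) = M⁴+M⁻⁴−M²−M⁻²−2−L−L⁻¹ one has |A| = |16c⁴−20c²+2−2cos φ| on the torus (c = cos θ) and
π·m(A) = vol(4₁) = 2D(e^{iπ/3}) = 2π·m(1+x+y) (Boyd2002Hyperbolic; BoydRodriguezVillegas2005; ratio
re-certified here to 4e−7): the unfolded torus representation of M(A) (integrand ±2/((1+t²)(1+s²)u))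
is KZ-equivalent to that of 2·M(1+x+y) (integrand ±4/(…)). Predicted chain: JensenMove (roots L_±(θ)
real algebraic, |L₋| ≥ 1 iff |c(θ)| ≥ 2), then the gluing-equation witness z∧(1−z) of the two
regular ideal tetrahedra (shape field ℚ(ζ₆)) via SteinbergChain, landing on the same ray reps as
SmythCalibration. Two Mahler measures of different curves related by an explicit K₂ witness — the
sector's cleanest non-CM-free test. [difficulty: L] -/
@[route_item "route-KontsevichZagierPeriods-K2SymbolChains"]
def FigureEightIsTwoSmyth : Prop :=
  ∀ (r r' : Literature.NumberTheory.Transcendental.KZ.IntegralRep 3), r.domain = {w | (1 < w 2 ∧ w 2 < (16 * ((1 - w 0 ^ 2) / (1 + w 0 ^ 2)) ^ 4 - 20 * ((1 - w 0 ^ 2) / (1 + w 0 ^ 2)) ^ 2 + 2 - 2 * (1 - w 1 ^ 2) / (1 + w 1 ^ 2)) ^ 2) ∨ ((16 * ((1 - w 0 ^ 2) / (1 + w 0 ^ 2)) ^ 4 - 20 * ((1 - w 0 ^ 2) / (1 + w 0 ^ 2)) ^ 2 + 2 - 2 * (1 - w 1 ^ 2) / (1 + w 1 ^ 2)) ^ 2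 < w 2 ∧ w 2 < 1)} → Set.EqOn r.integrand (fun w => (if 1 < w 2 then (1:ℝ) else -1) * 2 / ((1 + w 0 ^ 2) * (1 + w 1 ^ 2) * w 2)) r.domain → r'.domain = {w | (1 < w 2 ∧ w 2 < ((1 + (1 - w 0 ^ 2) / (1 + w 0 ^ 2) + (1 - w 1 ^ 2) / (1 + w 1 ^ 2)) ^ 2 + (2 * w 0 / (1 + w 0 ^ 2) + 2 * w 1 / (1 + w 1 ^ 2)) ^ 2)) ∨ (((1 + (1 - w 0 ^ 2) / (1 + w 0 ^ 2) + (1 - w 1 ^ 2) / (1 + w 1 ^ 2)) ^ 2 + (2 * w 0 / (1 + w 0 ^ 2) + 2 * w 1 / (1 + w 1 ^ 2)) ^ 2) < w 2 ∧ w 2 < 1)} → Set.EqOn r'.integrand (fun w => (if 1 < w 2 then (1:ℝ) else -1) * 4 / ((1 + w 0 ^ 2) * (1 + w 1 ^ 2) * w 2)) r'.domain → Literature.NumberTheory.Transcendental.KZ.Equivalent r r'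

/-- item stmt-KontsevichZagierPeriods-5204 · support · rank 9 · closed · proved by Summit.KontsevichZagierPeriods.K2SymbolChains.jensenIsScissors_proof @ 9a727323f648 (prover) · by planner
sources: Jensen1899, MckeeSmyth2021, KontsevichZagier2001
[support] the sharper form of crux 3 recorded by the planner's chain: every JensenMove instance
already lies in the subgroup generated by rules (1a), (1b), (2) ALONE — Jensen's formula is
scissors-and-dilation, no Newton–Leibniz/Stokes is used (doubling + radial constancy + inversion are
all changes of variables and additivity). Implies JensenMove (closure_mono, checked in Sketch.lean);
filed as support so that a failure of the NL-free chain does not block the route. [difficulty: L] -/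
@[route_item "route-KontsevichZagierPeriods-K2SymbolChains"]
def JensenIsScissors : Prop :=
  ∀ (n : ℕ) (τ : Set (Fin n → ℝ)) (h α₁ α₂ : (Fin n → ℝ) → ℝ) (r r' : Literature.NumberTheory.Transcendental.KZ.IntegralRep (n + 2)), Literature.ModelTheory.ExponentialFields.IsSemialgebraic ℚ τ → Literature.NumberTheory.Transcendental.IsSemialgebraicFunOn ℚ τ h → Literature.NumberTheory.Transcendental.IsSemialgebraicFunOn ℚ τ α₁ → Literature.NumberTheory.Transcendental.IsSemialgebraicFunOn ℚ τ α₂ → MeasureTheory.IntegrableOn (fun x => h x * (1 + |Real.log (α₁ x ^ 2 + α₂ x ^ 2)|)) τ → r.domain = {w | (fun i : Fin n => w (Fin.castAdd 2 i)) ∈ τ ∧ ((1 < w (Fin.natAdd n 1) ∧ w (Fin.natAdd n 1) < (((1 - w (Fin.natAdd n 0) ^ 2) / (1 + w (Fin.natAdd n 0) ^ 2) - α₁ (fun i : Fin n => w (Fin.castAdd 2 i))) ^ 2 + (2 * w (Fin.natAdd n 0) / (1 + w (Fin.natAdd n 0) ^ 2) - α₂ (fun i : Fin n => w (Fin.castAdd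 2 i))) ^ 2)) ∨ ((((1 - w (Fin.natAdd n 0) ^ 2) / (1 + w (Fin.natAdd n 0) ^ 2) - α₁ (fun i : Fin n => w (Fin.castAdd 2 i))) ^ 2 + (2 * w (Fin.natAdd n 0) / (1 + w (Fin.natAdd n 0) ^ 2) - α₂ (fun i : Fin n => w (Fin.castAdd 2 i))) ^ 2) < w (Fin.natAdd n 1) ∧ w (Fin.natAdd n 1) < 1))} → (∀ w ∈ r.domain, r.integrand w = (if 1 < w (Fin.natAdd n 1) then (1:ℝ) else -1) * h (fun i : Fin n => w (Fin.castAdd 2 i)) / ((1 + w (Fin.natAdd n 0) ^ 2) * w (Fin.natAdd n 1))) → r'.domain = {w | (fun i : Fin n => w (Fin.castAdd 2 i)) ∈ τ ∧ 1 < w (Fin.natAdd n 1) ∧ w (Fin.natAdd n 1) < α₁ (fun i : Fin n => w (Fin.castAdd 2 i)) ^ 2 + α₂ (fun i : Fin n => w (Fin.castAdd 2 i)) ^ 2} → (∀ w ∈ r'.domain, r'.integrand w = h (fun i : Fin n => w (Fin.castAdd 2 i)) / ((1 + w (Fin.natAdd n 0) ^ 2) * w (Fin.natAdd n 1))) → Literature.NumberTheory.Transcendental.KZ.of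 r - Literature.NumberTheory.Transcendental.KZ.of r' ∈ AddSubgroup.closure (Literature.NumberTheory.Transcendental.KZ.domainAddRel ∪ Literature.NumberTheory.Transcendental.KZ.integrandAddRel ∪ Literature.NumberTheory.Transcendental.KZ.changeOfVariablesRel)

/-- item stmt-KontsevichZagierPeriods-5205 · assembly · rank 1 · closed · proved by Summit.KontsevichZagierPeriods.K2SymbolChains.assembly_proof (prover) · by planner
sources: KontsevichZagier2001, HuberMullerStach2017
[assembly] JensenMove → SteinbergChain → SymbolKernel → KontsevichZagierPeriods (one λ-term: `fun hJ
hS hK => kontsevichZagierPeriods_of_kzKernelConjecture (fun c hc => hK KZ.relations le_rfl hJ hS c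
hc)`). -/
@[route_item "route-KontsevichZagierPeriods-K2SymbolChains"]
def Assembly : Prop :=
  JensenMove → SteinbergChain → SymbolKernel → KontsevichZagierPeriods

/-! D-0027 §2.1 — DECIDING THEOREM (planner-authored via `route open/edit --closes-file`; by planner-rbadge-KontsevichZagierPeriods-K2Symbo-5e41e823-g2-0 2026-08-15T16:11:24Z):
its hypotheses are this route's items and its conclusion the sub-problem Statement (glue_lint), and it elaborates with this file. -/

@[closes "route-KontsevichZagierPeriods-K2SymbolChains"] theorem closes : JensenMove → SteinbergChain → SymbolKernel → KontsevichZagierPeriods := by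
  intro hJ hS hK n m r r' _ _ hv
  have h0 : Literature.NumberTheory.Transcendental.KZ.eval
      (Literature.NumberTheory.Transcendental.KZ.of r - Literature.NumberTheory.Transcendental.KZ.of r') = 0 := by
    simp [Literature.NumberTheory.Transcendental.KZ.eval_of, hv]
  exact hK Literature.NumberTheory.Transcendental.KZ.relations le_rfl hJ hS _ h0

end Summit.KontsevichZagierPeriods.KontsevichZagierPeriods.Theses.K2SymbolChains
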